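import Summits.CriticalPhenomena.Ising3DConformalLimit.Theorems.UniformRegularity.Negative.LoadBearing
import Mathlib.Analysis.SpecificLimits.Basic
import HarnessLib

/-!
# Crux `UniformRegularity` (item stmt-CriticalPhenomena-4658) — the constants `M_K` of clause (a) and `m_K` of clause (c)
# cannot be chosen uniformly in the compact `K` (standing crux disprover, cycle 1)

THEOREM-ONLY negative lemmas (no positive route-item conclusion), continuing `Negative/LoadBearing.lean` and
`Negative/QuantifierLoadBearing.lean`. `F_δ(2; 0, t e₀) = g(⌊t/δ⌋e₀)/g(⌊δ⁻¹⌋e₀)`, `g(w) = ⟨σ₀σ_w⟩⁺_{β_c}` (`rescaled_pair_unitVec`).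

* `clauseA_false_with_bound_uniform_in_K` : the strengthening of clause (a) with ONE bound `M` for every compact
  `K ⊆ NonCoincident 3 2` is FALSE. Witness the singletons `K_m = {(0, e₀/m)}`, `m > M` an integer: if
  `g(⌊N/m⌋e₀) ≤ M g(N e₀)` held for all large meshes `δ = 1/N`, then along `N = N₀ mʲ` one would get
  `g(N₀ mʲ e₀) ≥ M^{-j} g(N₀ e₀)`, against the infrared bound `g(N₀ mʲ e₀) ≤ C/(N₀ mʲ)` since `m/M > 1`.
* `clauseC_false_with_bound_uniform_in_K` : the strengthening of clause (c) with ONE lower constant `m > 0` for every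
  compact `K ⊆ NonCoincident 3 2` is FALSE. Witness `K_p = {(0, p e₀)}`, `p > 1/m` an integer: `g(pN e₀) ≥ m g(N e₀)` for all
  large `N` would give `g(N₀ pʲ e₀) ≥ mʲ g(N₀ e₀)`, against `g ≤ C/(N₀ pʲ)` since `p m > 1`.

So in the crux the order of quantifiers `∀ K ∃ M` / `∀ K ∃ m` is load-bearing: `M_K → ∞` as `K` approaches the diagonal and
`m_K → 0` as `K` recedes to infinity (in the expected world `F → t^{-(1+η)}`). Only the infrared upper bound `g(k e₀) ≤ C/k`
and `g > 0` are used (tree theorem `criticalTwoPoint_bounds_holds`).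

References: J. Fröhlich, B. Simon, T. Spencer, Comm. Math. Phys. 50 (1976) 79 (infrared bound); B. Simon, Comm. Math. Phys. 77
(1980) 111; A. Messager, S. Miracle-Solé, J. Stat. Phys. 17 (1977) 245.
-/

open Summit.CriticalPhenomena.Ising3DConformalLimit.Theses
open Literature.Probability.LatticeModels
open Filter Set
open scoped Topology
open Summit.CriticalPhenomena.Ising3DConformalLimit.PinnedClusterPoints (criticalTwoPoint_pos3)

namespace Summit.CriticalPhenomena.Ising3DConformalLimit.UniformRegularityNegative

/-- The infrared upper bound along the axis at natural arguments: `g(k e₀) ≤ C/k` for `k ≥ 1`. [folklore] -/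
theorem exists_axis_upper : ∃ C : ℝ, ∀ k : ℕ, 1 ≤ k → criticalTwoPoint 3 (Pi.single (0 : Fin 3) (k : ℤ)) ≤ C / (k : ℝ) := by
  obtain ⟨c, C, hc, hb⟩ := criticalTwoPoint_bounds_holds (d := 3) le_rfl
  refine ⟨C, fun k hk => ?_⟩
  have hkpos : (0:ℝ) < k := by exact_mod_cast hk
  have hx : (Pi.single (0 : Fin 3) (k : ℤ) : Site 3) ≠ 0 := by
    intro h0
    have := congrFun h0 0
    rw [Pi.single_eq_same] at this
    have : (k : ℤ) = 0 := this
    omega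
  have h2 := (hb _ hx).2
  rw [norm_single_axis, Int.cast_natCast, abs_of_pos hkpos,
    show (-(((3:ℕ):ℝ) - 2)) = -1 by norm_num, Real.rpow_neg_one] at h2
  rwa [div_eq_mul_inv]

/-- The pinned pair correlator at `(0, t e₀)` read at the mesh `δ = 1/N` with `t/δ` an integer `K'`:
`F_{1/N}(2; 0, t e₀) = g(K' e₀)/g(N e₀)`. [folklore] -/
theorem rescaled_pair_at_intMesh {N K' : ℕ} {t : ℝ} (ht : t * N = K') :
    rescaledCorrelator (criticalCorr 3) (fun δ : ℝ => (criticalTwoPoint 3 (Pi.single 0 ⌊δ⁻¹⌋)) ^ (-(1/2:ℝ))) 2 ((N:ℝ)⁻¹)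
        ![0, EuclideanSpace.single (0 : Fin 3) t] =
      (criticalTwoPoint 3 (Pi.single (0 : Fin 3) (N : ℤ)))⁻¹ * criticalTwoPoint 3 (Pi.single (0 : Fin 3) (K' : ℤ)) := by
  rw [rescaled_pair_unitVec, inv_inv, Int.floor_natCast, div_inv_eq_mul, ht, Int.floor_natCast]

/-- Meshes `δ = 1/N` are admissible below `δ₀` once `N > 1/δ₀`. [folklore] -/
theorem inv_nat_mem_Ioo {δ₀ : ℝ} (hδ₀ : 0 < δ₀) {N₀ N : ℕ} (hN₀ : δ₀⁻¹ < N₀) (hN : N₀ ≤ N) :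
    (N:ℝ)⁻¹ ∈ Set.Ioo 0 δ₀ := by
  have hN' : δ₀⁻¹ < N := lt_of_lt_of_le hN₀ (by exact_mod_cast hN)
  have hNpos : (0:ℝ) < N := (inv_pos.2 hδ₀).trans hN'
  refine ⟨inv_pos.2 hNpos, ?_⟩
  calc (N:ℝ)⁻¹ < (δ₀⁻¹)⁻¹ := (inv_lt_inv₀ hNpos (inv_pos.2 hδ₀)).2 hN'
    _ = δ₀ := inv_inv δ₀

/-- **One `M` for all `K` is false (clause (a)).** The strengthening of clause (a) of the crux in which a single bound `M`
serves every compact `K ⊆ NonCoincident 3 2` fails: on `K = {(0, e₀/m)}` with an integer `m > M`, the bound along the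
meshes `1/(N₀ mʲ⁺¹)` forces `g(N₀ mʲ e₀) ≥ M^{-j} g(N₀ e₀)`, against the infrared bound. [folklore] -/
theorem clauseA_false_with_bound_uniform_in_K :
    ¬ ∃ M : ℝ, ∀ K : Set (Fin 2 → EuclideanSpace ℝ (Fin 3)), K ⊆ NonCoincident 3 2 → IsCompact K →
        ∃ δ₀ : ℝ, 0 < δ₀ ∧ ∀ δ ∈ Set.Ioo 0 δ₀, ∀ x ∈ K,
          |rescaledCorrelator (criticalCorr 3)
              (fun δ : ℝ => (criticalTwoPoint 3 (Pi.single 0 ⌊δ⁻¹⌋)) ^ (-(1/2:ℝ))) 2 δ x| ≤ M := by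
  rintro ⟨M, h⟩
  obtain ⟨C, hC⟩ := exists_axis_upper
  -- an integer `m ≥ 2` with `M < m`
  obtain ⟨m, hm⟩ := exists_nat_gt (max M 2)
  have hmM : M < m := lt_of_le_of_lt (le_max_left _ _) hm
  have hm2 : (2:ℝ) < m := lt_of_le_of_lt (le_max_right _ _) hm
  have hmpos : (0:ℝ) < m := by linarith
  have hm1 : 1 ≤ m := by exact_mod_cast (show (1:ℝ) ≤ m by linarith)
  -- the compact singleton `K = {(0, e₀/m)}`
  set x₀ : Fin 2 → EuclideanSpace ℝ (Fin 3) := ![0, EuclideanSpace.single (0 : Fin 3) ((m:ℝ)⁻¹)] with hx₀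
  obtain ⟨δ₀, hδ₀, hb⟩ := h {x₀}
    (by intro x hx; rw [Set.mem_singleton_iff] at hx; subst hx
        exact zero_unitVec_mem_nonCoincident (inv_pos.2 hmpos).ne') isCompact_singleton
  obtain ⟨N₀, hN₀⟩ := exists_nat_gt (max δ₀⁻¹ 1)
  have hN₀δ : δ₀⁻¹ < N₀ := lt_of_le_of_lt (le_max_left _ _) hN₀
  have hN₀1 : (1:ℝ) < N₀ := lt_of_le_of_lt (le_max_right _ _) hN₀
  have hN₀pos : (0:ℝ) < N₀ := by linarith
  have hN₀nat : 1 ≤ N₀ := by exact_mod_cast hN₀1.le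
  -- `G j = g(N₀ mʲ e₀)`
  set G : ℕ → ℝ := fun j => criticalTwoPoint 3 (Pi.single (0 : Fin 3) ((N₀ * m ^ j : ℕ) : ℤ)) with hG
  have hGpos : ∀ j, 0 < G j := fun j => criticalTwoPoint_pos3 _
  -- one step: `G j ≤ M * G (j+1)` from the bound at the mesh `1/(N₀ m^{j+1})`
  have hstep : ∀ j, G j ≤ M * G (j + 1) := by
    intro j
    have hNj : N₀ ≤ N₀ * m ^ (j + 1) := Nat.le_mul_of_pos_right _ (pow_pos (by omega) _)
    have ht : (m:ℝ)⁻¹ * ((N₀ * m ^ (j + 1) : ℕ) : ℝ) = ((N₀ * m ^ j : ℕ) : ℝ) := by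
      rw [inv_mul_eq_iff_eq_mul₀ hmpos.ne']; push_cast; ring
    have hv := hb _ (inv_nat_mem_Ioo hδ₀ hN₀δ hNj) x₀ (Set.mem_singleton _)
    rw [hx₀, rescaled_pair_at_intMesh ht] at hv
    have hA : 0 < (criticalTwoPoint 3 (Pi.single (0 : Fin 3) ((N₀ * m ^ (j + 1) : ℕ) : ℤ)))⁻¹ :=
      inv_pos.2 (hGpos (j + 1))
    rw [abs_of_pos (mul_pos hA (hGpos j))] at hv
    -- `g(N')⁻¹ g(K') ≤ M` ⟹ `g(K') ≤ M g(N')`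
    have := mul_le_mul_of_nonneg_left hv (hGpos (j + 1)).le
    rw [← mul_assoc, mul_inv_cancel₀ (hGpos (j + 1)).ne', one_mul] at this
    simpa [hG, mul_comm] using this
  have hM0 : 0 ≤ M := by
    have := hstep 0
    by_contra hneg
    push Not at hneg
    have : G 0 ≤ M * G 1 := this
    nlinarith [hGpos 0, hGpos 1]
  -- iterate: `G 0 ≤ M^j G j ≤ M^j C/(N₀ m^j)`
  have hiter : ∀ j, G 0 ≤ M ^ j * G j := by
    intro j
    induction j with
    | zero => simp
    | succ j ih =>
      calc G 0 ≤ M ^ j * G j := ih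
        _ ≤ M ^ j * (M * G (j + 1)) := mul_le_mul_of_nonneg_left (hstep j) (pow_nonneg hM0 j)
        _ = M ^ (j + 1) * G (j + 1) := by rw [pow_succ]; ring
  have hup : ∀ j, G j ≤ C / ((N₀:ℝ) * (m:ℝ) ^ j) := by
    intro j
    have h1 : 1 ≤ N₀ * m ^ j := hN₀nat.trans (Nat.le_mul_of_pos_right _ (pow_pos (by omega) _))
    have := hC (N₀ * m ^ j) h1
    push_cast at this
    exact this
  have hCpos : 0 < C := by
    have := (hGpos 0).trans_le (hup 0)
    rw [pow_zero, mul_one] at this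
    exact (div_pos_iff_of_pos_right hN₀pos).1 this
  -- `G 0 ≤ (C/N₀) (M/m)^j → 0`
  have hbound : ∀ j, G 0 ≤ C / N₀ * (M / m) ^ j := by
    intro j
    calc G 0 ≤ M ^ j * G j := hiter j
      _ ≤ M ^ j * (C / ((N₀:ℝ) * (m:ℝ) ^ j)) := mul_le_mul_of_nonneg_left (hup j) (pow_nonneg hM0 j)
      _ = C / N₀ * (M / m) ^ j := by
          rw [div_pow]; field_simp
  have hq : M / m < 1 := (div_lt_one hmpos).2 hmM
  have hq0 : 0 ≤ M / m := div_nonneg hM0 hmpos.le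
  have hlim : Tendsto (fun j : ℕ => C / N₀ * (M / m) ^ j) atTop (𝓝 (C / N₀ * 0)) :=
    (tendsto_pow_atTop_nhds_zero_of_lt_one hq0 hq).const_mul _
  rw [mul_zero] at hlim
  have hev := hlim.eventually (gt_mem_nhds (hGpos 0))
  obtain ⟨j, hj⟩ := hev.exists
  exact absurd (hbound j) (not_le.2 hj)

/-- **One `m` for all `K` is false (clause (c)).** The strengthening of clause (c) of the crux in which a single positive lower
constant `m` serves every compact `K ⊆ NonCoincident 3 2` fails: on `K = {(0, p e₀)}` with an integer `p > 1/m`, the bound along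
the meshes `1/(N₀ pʲ)` forces `g(N₀ pʲ e₀) ≥ mʲ g(N₀ e₀)`, against the infrared bound since `p m > 1`. [folklore] -/
theorem clauseC_false_with_bound_uniform_in_K :
    ¬ ∃ m : ℝ, 0 < m ∧ ∀ K : Set (Fin 2 → EuclideanSpace ℝ (Fin 3)), K ⊆ NonCoincident 3 2 → IsCompact K →
        ∃ δ₀ : ℝ, 0 < δ₀ ∧ ∀ δ ∈ Set.Ioo 0 δ₀, ∀ x ∈ K,
          m ≤ rescaledCorrelator (criticalCorr 3)
            (fun δ : ℝ => (criticalTwoPoint 3 (Pi.single 0 ⌊δ⁻¹⌋)) ^ (-(1/2:ℝ))) 2 δ x := by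
  rintro ⟨m, hm, h⟩
  obtain ⟨C, hC⟩ := exists_axis_upper
  -- an integer `p ≥ 2` with `1/m < p`
  obtain ⟨p, hp⟩ := exists_nat_gt (max m⁻¹ 2)
  have hpm : m⁻¹ < p := lt_of_le_of_lt (le_max_left _ _) hp
  have hp2 : (2:ℝ) < p := lt_of_le_of_lt (le_max_right _ _) hp
  have hppos : (0:ℝ) < p := by linarith
  have hp1 : 1 ≤ p := by exact_mod_cast (show (1:ℝ) ≤ p by linarith)
  have hpm1 : 1 < (p:ℝ) * m := by
    have := mul_lt_mul_of_pos_right hpm hm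
    rwa [inv_mul_cancel₀ hm.ne'] at this
  set x₀ : Fin 2 → EuclideanSpace ℝ (Fin 3) := ![0, EuclideanSpace.single (0 : Fin 3) (p:ℝ)] with hx₀
  obtain ⟨δ₀, hδ₀, hb⟩ := h {x₀}
    (by intro x hx; rw [Set.mem_singleton_iff] at hx; subst hx
        exact zero_unitVec_mem_nonCoincident hppos.ne') isCompact_singleton
  obtain ⟨N₀, hN₀⟩ := exists_nat_gt (max δ₀⁻¹ 1)
  have hN₀δ : δ₀⁻¹ < N₀ := lt_of_le_of_lt (le_max_left _ _) hN₀
  have hN₀1 : (1:ℝ) < N₀ := lt_of_le_of_lt (le_max_right _ _) hN₀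
  have hN₀pos : (0:ℝ) < N₀ := by linarith
  have hN₀nat : 1 ≤ N₀ := by exact_mod_cast hN₀1.le
  set G : ℕ → ℝ := fun j => criticalTwoPoint 3 (Pi.single (0 : Fin 3) ((N₀ * p ^ j : ℕ) : ℤ)) with hG
  have hGpos : ∀ j, 0 < G j := fun j => criticalTwoPoint_pos3 _
  -- one step: `m * G j ≤ G (j+1)` from the lower bound at the mesh `1/(N₀ p^j)`
  have hstep : ∀ j, m * G j ≤ G (j + 1) := by
    intro j
    have hNj : N₀ ≤ N₀ * p ^ j := Nat.le_mul_of_pos_right _ (pow_pos (by omega) _)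
    have ht : (p:ℝ) * ((N₀ * p ^ j : ℕ) : ℝ) = ((N₀ * p ^ (j + 1) : ℕ) : ℝ) := by push_cast; ring
    have hv := hb _ (inv_nat_mem_Ioo hδ₀ hN₀δ hNj) x₀ (Set.mem_singleton _)
    rw [hx₀, rescaled_pair_at_intMesh ht] at hv
    -- `m ≤ g(N')⁻¹ g(K')` ⟹ `m g(N') ≤ g(K')`
    have := mul_le_mul_of_nonneg_left hv (hGpos j).le
    rw [← mul_assoc, mul_inv_cancel₀ (hGpos j).ne', one_mul] at this
    simpa [hG, mul_comm] using this
  have hiter : ∀ j, m ^ j * G 0 ≤ G j := by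
    intro j
    induction j with
    | zero => simp
    | succ j ih =>
      calc m ^ (j + 1) * G 0 = m * (m ^ j * G 0) := by rw [pow_succ]; ring
        _ ≤ m * G j := mul_le_mul_of_nonneg_left ih hm.le
        _ ≤ G (j + 1) := hstep j
  have hup : ∀ j, G j ≤ C / ((N₀:ℝ) * (p:ℝ) ^ j) := by
    intro j
    have h1 : 1 ≤ N₀ * p ^ j := hN₀nat.trans (Nat.le_mul_of_pos_right _ (pow_pos (by omega) _))
    have := hC (N₀ * p ^ j) h1
    push_cast at this
    exact this
  -- `(p m)^j G 0 ≤ C/N₀`, against `(p m)^j → ∞`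
  have hbound : ∀ j, ((p:ℝ) * m) ^ j * G 0 ≤ C / N₀ := by
    intro j
    have h1 : m ^ j * G 0 ≤ C / ((N₀:ℝ) * (p:ℝ) ^ j) := (hiter j).trans (hup j)
    have hpj : (0:ℝ) < (p:ℝ) ^ j := pow_pos hppos j
    rw [le_div_iff₀ (mul_pos hN₀pos hpj)] at h1
    rw [le_div_iff₀ hN₀pos, mul_pow]
    nlinarith
  have hlim : Tendsto (fun j : ℕ => ((p:ℝ) * m) ^ j * G 0) atTop atTop :=
    (tendsto_pow_atTop_atTop_of_one_lt hpm1).atTop_mul_const (hGpos 0)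
  obtain ⟨j, hj⟩ := (hlim.eventually (eventually_gt_atTop (C / N₀))).exists
  exact absurd (hbound j) (not_le.2 hj)

end Summit.CriticalPhenomena.Ising3DConformalLimit.UniformRegularityNegative
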